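import Mathlib
import HarnessLib
import Summits.ResolutionOfSingularities.ResolutionOfSingularities.Theorems.HomologicalConductorPersistenceKC3XbSpanMem
import Summits.ResolutionOfSingularities.ResolutionOfSingularities.Theorems.HomologicalConductorPersistenceCleanPivots

/-!
# Crux `Persistence` (stmt-ResolutionOfSingularities-16484), chain W4.4b — K-C3 K4e (4/4):
# `X_b` is a lattice — `Module.Projective ↥(kc3P k) (kc3Xb k)`

Route `ResolutionOfSingularities/HomologicalConductor`.  OURS (cell res-hironaka, crux chain W4.4b, K-C3 K4e,
CHAIN v13.5 §V13.13; res-D-pv-037 K4e-NOTE / INTERFACE «K4e = `Module.Projective ↥(kc3P k) X_b`»; seat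
res-D-pv-058); nothing here is a statement of the manuscript under review (Hironaka 2017); AI-written,
weaker than expert review.

Parts 1–3 (`…KC3XbGens`, `…KC3XbSpan`, `…KC3XbSpanMem`) showed `N|_{P₀} = span_{P₀} {w₀, …, w₁₇}` for the relation module
`N = ∂ W₀¹²` of `X_b = W₀⁸ ⧸ N`.  Here: the PIVOT READING `piv : W₀⁸ →ₗ[P₀] P₀¹⁸`, `piv_p(f) =` the
`β_{j_p}`-coordinate (res-D-pv-037 `kc3Basis`) of the entry `f (g_p)` at the eighteen pivot coordinates
`(g_p, j_p)` of the certificate; `piv (w q) = e_q` (the 18 × 18 coordinate matrix is the identity —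
`piv_w`, 324 coordinate evaluations), so `PersistenceCleanPivots.projective_quotient_restrictScalars_of_pivots`
gives

* **`kc3Xb_projective : Module.Projective ↥(kc3P k) (kc3Xb k)`** — `X_b` is a lattice over the Frobenius
  `P₀`-order `W₀` (in fact `X_b ≅ P₀³⁰`; MCM of rank 5 over `W₀`, K-C3-REPRO §2): the instance hypothesis
  `[Module.Projective ↥(kc3P k) L]`, `L := kc3Xb k`, of res-D-pv-037's K5 socket.
[OURS; a finite certificate.]
-/

noncomputable section

-- single-problem summit: the doubled namespace component `ResolutionOfSingularities` is forced
set_option linter.dupNamespace false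
-- generated certificate file: one uniform `simp only` list serves all component checks
set_option linter.unusedSimpArgs false

open MvPolynomial
open Summit.ResolutionOfSingularities.ResolutionOfSingularities.Theorems.HomologicalConductor.KC3Witness
open Summit.ResolutionOfSingularities.ResolutionOfSingularities.Theorems.HomologicalConductor.KC3FrobeniusOrder
open Summit.ResolutionOfSingularities.ResolutionOfSingularities.Theorems.HomologicalConductor.KC3WitnessBaseChange
open Summit.ResolutionOfSingularities.ResolutionOfSingularities.Theorems.HomologicalConductor.PersistenceCleanPivots

universe u

namespace Summit.ResolutionOfSingularities.ResolutionOfSingularities.Theorems.HomologicalConductor.KC3XbLattice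

variable (k : Type u) [Field k]

/-! ## The pivot reading -/

/-- Row index `g_p` of the `p`-th pivot coordinate. [OURS · certificate] -/
def pivG : Fin 18 → Fin 8 := ![0, 0, 0, 1, 0, 0, 2, 1, 2, 2, 2, 2, 7, 3, 3, 4, 6, 5]

/-- Box index `j_p` of the `p`-th pivot coordinate (`β = (1, a⁴b, a²b², a³c, abc, a⁵b²c)`). [OURS · certificate] -/
def pivJ : Fin 18 → Fin 6 := ![4, 5, 2, 5, 1, 3, 3, 2, 4, 5, 2, 1, 5, 4, 5, 5, 5, 5]

/-- Evaluation at `g`, as a `P₀`-linear map `W₀⁸ → W₀`. [folklore] -/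
def projP (g : Fin 8) : (Fin 8 → ↥(kc3W k)) →ₗ[↥(kc3P k)] ↥(kc3W k) where
  toFun f := f g
  map_add' _ _ := rfl
  map_smul' _ _ := rfl

/-- **The pivot reading** `piv : W₀⁸ →ₗ[P₀] P₀¹⁸`, `piv_p (f) = coord_{j_p} (f (g_p))`. [OURS] -/
def piv : (Fin 8 → ↥(kc3W k)) →ₗ[↥(kc3P k)] (Fin 18 → ↥(kc3P k)) :=
  LinearMap.pi fun p => (kc3Basis k).coord (pivJ p) ∘ₗ projP k (pivG p)

variable {k}

/-- `piv` componentwise. [OURS] -/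
theorem piv_apply (f : Fin 8 → ↥(kc3W k)) (p : Fin 18) :
    piv k f p = (kc3Basis k).coord (pivJ p) (f (pivG p)) := rfl

/-- `scMonomial q 0 = 0`. [folklore] -/
@[simp] theorem scMonomial_zero_right (q : Fin 3 →₀ ℕ) : scMonomial k q (0 : k) = 0 :=
  Subtype.ext (by simp)

/-- `scMonomial (e 0 0 0) 1 = 1`. [folklore] -/
@[simp] theorem scMonomial_e_zero_one : scMonomial k (e 0 0 0) (1 : k) = 1 := by
  rw [e_zero]; exact scMonomial_zero_one

/-- `scMonomial (e 0 0 0) (-1) = -1`. [folklore] -/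
@[simp] theorem scMonomial_e_zero_neg_one : scMonomial k (e 0 0 0) (-1 : k) = -1 :=
  Subtype.ext (by simp [sc, e_zero])

/-- **Coordinates of a monomial of `W₀`** on the box basis (res-D-pv-037 `kc3Basis_repr_monomial`, stated for
an arbitrary membership witness and every coefficient; for `c = 0` both sides vanish). [OURS] -/
theorem repr_mk_monomial (d : Fin 3 →₀ ℕ) (c : k) (h : monomial d c ∈ kc3W k) :
    (kc3Basis k).repr ⟨monomial d c, h⟩ = Finsupp.single (boxIdx d) (scMonomial k (quo d) c) := by
  rcases eq_or_ne c 0 with rfl | hc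
  · have h0 : (⟨monomial d (0 : k), h⟩ : ↥(kc3W k)) = 0 := Subtype.ext (by simp)
    rw [h0, map_zero, scMonomial_zero_right, Finsupp.single_zero]
  · classical
    have hd : 6 ∣ wt d := (mem_kc3W_iff.mp h) d (by
      rw [support_monomial, if_neg hc]; exact Finset.mem_singleton_self d)
    exact kc3Basis_repr_monomial hd c

/-- `repr ⟨0, h⟩ = 0`. [folklore] -/
theorem repr_mk_zero (h : (0 : MvPolynomial (Fin 3) k) ∈ kc3W k) : (kc3Basis k).repr ⟨0, h⟩ = 0 := by
  have h0 : (⟨0, h⟩ : ↥(kc3W k)) = 0 := rfl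
  rw [h0, map_zero]

/-- `repr ⟨-x, h⟩ = -repr ⟨x, _⟩`. [folklore] -/
theorem repr_mk_neg (x : MvPolynomial (Fin 3) k) (h : -x ∈ kc3W k) :
    (kc3Basis k).repr ⟨-x, h⟩ = -(kc3Basis k).repr ⟨x, neg_mem_iff.mp h⟩ := by
  have h0 : (⟨-x, h⟩ : ↥(kc3W k)) = -⟨x, neg_mem_iff.mp h⟩ := rfl
  rw [h0, map_neg]

/-- Extensionality of `P₀¹⁸` through the eighteen components. [folklore] -/
theorem ext18 {f f' : Fin 18 → ↥(kc3P k)}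
    (h : ∀ i ∈ ([0, 1, 2, 3, 4, 5, 6, 7, 8, 9, 10, 11, 12, 13, 14, 15, 16, 17] : List (Fin 18)), f i = f' i) :
    f = f' := by
  funext i; fin_cases i <;> exact h _ (by decide)

/-! ## The 18 × 18 coordinate matrix is the identity -/

/-- `piv (w 0) = e_0` (18 coordinate evaluations). [OURS · certificate] -/
theorem piv_w_0 : piv k (w k 0) = Pi.single 0 1 :=
  ext18 fun p hp => by
    fin_cases hp <;> simp +decide only [piv_apply, pivJ, pivG, Matrix.cons_val, Fin.isValue, w, gen, col,
      Pi.smul_apply, Pi.add_apply, Pi.neg_apply, Pi.sub_apply, smul_eq_mul, kc3DW, Matrix.of_apply, kc3D,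
      boxMonomial, box, MulMemClass.mk_mul_mk, monomial_mul, mul_one, one_mul, mul_neg, mul_zero, e_add,
      Nat.reduceAdd, Nat.reduceMul, Nat.reduceMod, Nat.reduceDiv, map_add, map_neg, map_zero, LinearMap.map_neg,
      Module.Basis.coord_apply, repr_mk_neg, repr_mk_monomial, repr_mk_zero, Finsupp.single_apply, Finsupp.coe_add,
      Finsupp.coe_neg, Finsupp.coe_zero, Pi.zero_apply, boxIdx, quo, e_apply_zero, e_apply_one, e_apply_two,
      scMonomial_e_zero_one, scMonomial_e_zero_neg_one, Pi.single_apply, if_true, if_false, neg_zero, neg_neg,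
      add_zero, zero_add, neg_add_cancel, add_neg_cancel, Fin.mk.injEq, Fin.ext_iff, Fin.val_zero, Fin.val_one, Fin.val_two]

/-- `piv (w 1) = e_1` (18 coordinate evaluations). [OURS · certificate] -/
theorem piv_w_1 : piv k (w k 1) = Pi.single 1 1 :=
  ext18 fun p hp => by
    fin_cases hp <;> simp +decide only [piv_apply, pivJ, pivG, Matrix.cons_val, Fin.isValue, w, gen, col,
      Pi.smul_apply, Pi.add_apply, Pi.neg_apply, Pi.sub_apply, smul_eq_mul, kc3DW, Matrix.of_apply, kc3D,
      boxMonomial, box, MulMemClass.mk_mul_mk, monomial_mul, mul_one, one_mul, mul_neg, mul_zero, e_add,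
      Nat.reduceAdd, Nat.reduceMul, Nat.reduceMod, Nat.reduceDiv, map_add, map_neg, map_zero, LinearMap.map_neg,
      Module.Basis.coord_apply, repr_mk_neg, repr_mk_monomial, repr_mk_zero, Finsupp.single_apply, Finsupp.coe_add,
      Finsupp.coe_neg, Finsupp.coe_zero, Pi.zero_apply, boxIdx, quo, e_apply_zero, e_apply_one, e_apply_two,
      scMonomial_e_zero_one, scMonomial_e_zero_neg_one, Pi.single_apply, if_true, if_false, neg_zero, neg_neg,
      add_zero, zero_add, neg_add_cancel, add_neg_cancel, Fin.mk.injEq, Fin.ext_iff, Fin.val_zero, Fin.val_one, Fin.val_two]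

/-- `piv (w 2) = e_2` (18 coordinate evaluations). [OURS · certificate] -/
theorem piv_w_2 : piv k (w k 2) = Pi.single 2 1 :=
  ext18 fun p hp => by
    fin_cases hp <;> simp +decide only [piv_apply, pivJ, pivG, Matrix.cons_val, Fin.isValue, w, gen, col,
      Pi.smul_apply, Pi.add_apply, Pi.neg_apply, Pi.sub_apply, smul_eq_mul, kc3DW, Matrix.of_apply, kc3D,
      boxMonomial, box, MulMemClass.mk_mul_mk, monomial_mul, mul_one, one_mul, mul_neg, mul_zero, e_add,
      Nat.reduceAdd, Nat.reduceMul, Nat.reduceMod, Nat.reduceDiv, map_add, map_neg, map_zero, LinearMap.map_neg,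
      Module.Basis.coord_apply, repr_mk_neg, repr_mk_monomial, repr_mk_zero, Finsupp.single_apply, Finsupp.coe_add,
      Finsupp.coe_neg, Finsupp.coe_zero, Pi.zero_apply, boxIdx, quo, e_apply_zero, e_apply_one, e_apply_two,
      scMonomial_e_zero_one, scMonomial_e_zero_neg_one, Pi.single_apply, if_true, if_false, neg_zero, neg_neg,
      add_zero, zero_add, neg_add_cancel, add_neg_cancel, Fin.mk.injEq, Fin.ext_iff, Fin.val_zero, Fin.val_one, Fin.val_two]

/-- `piv (w 3) = e_3` (18 coordinate evaluations). [OURS · certificate] -/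
theorem piv_w_3 : piv k (w k 3) = Pi.single 3 1 :=
  ext18 fun p hp => by
    fin_cases hp <;> simp +decide only [piv_apply, pivJ, pivG, Matrix.cons_val, Fin.isValue, w, gen, col,
      Pi.smul_apply, Pi.add_apply, Pi.neg_apply, Pi.sub_apply, smul_eq_mul, kc3DW, Matrix.of_apply, kc3D,
      boxMonomial, box, MulMemClass.mk_mul_mk, monomial_mul, mul_one, one_mul, mul_neg, mul_zero, e_add,
      Nat.reduceAdd, Nat.reduceMul, Nat.reduceMod, Nat.reduceDiv, map_add, map_neg, map_zero, LinearMap.map_neg,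
      Module.Basis.coord_apply, repr_mk_neg, repr_mk_monomial, repr_mk_zero, Finsupp.single_apply, Finsupp.coe_add,
      Finsupp.coe_neg, Finsupp.coe_zero, Pi.zero_apply, boxIdx, quo, e_apply_zero, e_apply_one, e_apply_two,
      scMonomial_e_zero_one, scMonomial_e_zero_neg_one, Pi.single_apply, if_true, if_false, neg_zero, neg_neg,
      add_zero, zero_add, neg_add_cancel, add_neg_cancel, Fin.mk.injEq, Fin.ext_iff, Fin.val_zero, Fin.val_one, Fin.val_two]

/-- `piv (w 4) = e_4` (18 coordinate evaluations). [OURS · certificate] -/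
theorem piv_w_4 : piv k (w k 4) = Pi.single 4 1 :=
  ext18 fun p hp => by
    fin_cases hp <;> simp +decide only [piv_apply, pivJ, pivG, Matrix.cons_val, Fin.isValue, w, gen, col,
      Pi.smul_apply, Pi.add_apply, Pi.neg_apply, Pi.sub_apply, smul_eq_mul, kc3DW, Matrix.of_apply, kc3D,
      boxMonomial, box, MulMemClass.mk_mul_mk, monomial_mul, mul_one, one_mul, mul_neg, mul_zero, e_add,
      Nat.reduceAdd, Nat.reduceMul, Nat.reduceMod, Nat.reduceDiv, map_add, map_neg, map_zero, LinearMap.map_neg,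
      Module.Basis.coord_apply, repr_mk_neg, repr_mk_monomial, repr_mk_zero, Finsupp.single_apply, Finsupp.coe_add,
      Finsupp.coe_neg, Finsupp.coe_zero, Pi.zero_apply, boxIdx, quo, e_apply_zero, e_apply_one, e_apply_two,
      scMonomial_e_zero_one, scMonomial_e_zero_neg_one, Pi.single_apply, if_true, if_false, neg_zero, neg_neg,
      add_zero, zero_add, neg_add_cancel, add_neg_cancel, Fin.mk.injEq, Fin.ext_iff, Fin.val_zero, Fin.val_one, Fin.val_two]

/-- `piv (w 5) = e_5` (18 coordinate evaluations). [OURS · certificate] -/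
theorem piv_w_5 : piv k (w k 5) = Pi.single 5 1 :=
  ext18 fun p hp => by
    fin_cases hp <;> simp +decide only [piv_apply, pivJ, pivG, Matrix.cons_val, Fin.isValue, w, gen, col,
      Pi.smul_apply, Pi.add_apply, Pi.neg_apply, Pi.sub_apply, smul_eq_mul, kc3DW, Matrix.of_apply, kc3D,
      boxMonomial, box, MulMemClass.mk_mul_mk, monomial_mul, mul_one, one_mul, mul_neg, mul_zero, e_add,
      Nat.reduceAdd, Nat.reduceMul, Nat.reduceMod, Nat.reduceDiv, map_add, map_neg, map_zero, LinearMap.map_neg,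
      Module.Basis.coord_apply, repr_mk_neg, repr_mk_monomial, repr_mk_zero, Finsupp.single_apply, Finsupp.coe_add,
      Finsupp.coe_neg, Finsupp.coe_zero, Pi.zero_apply, boxIdx, quo, e_apply_zero, e_apply_one, e_apply_two,
      scMonomial_e_zero_one, scMonomial_e_zero_neg_one, Pi.single_apply, if_true, if_false, neg_zero, neg_neg,
      add_zero, zero_add, neg_add_cancel, add_neg_cancel, Fin.mk.injEq, Fin.ext_iff, Fin.val_zero, Fin.val_one, Fin.val_two]

/-- `piv (w 6) = e_6` (18 coordinate evaluations). [OURS · certificate] -/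
theorem piv_w_6 : piv k (w k 6) = Pi.single 6 1 :=
  ext18 fun p hp => by
    fin_cases hp <;> simp +decide only [piv_apply, pivJ, pivG, Matrix.cons_val, Fin.isValue, w, gen, col,
      Pi.smul_apply, Pi.add_apply, Pi.neg_apply, Pi.sub_apply, smul_eq_mul, kc3DW, Matrix.of_apply, kc3D,
      boxMonomial, box, MulMemClass.mk_mul_mk, monomial_mul, mul_one, one_mul, mul_neg, mul_zero, e_add,
      Nat.reduceAdd, Nat.reduceMul, Nat.reduceMod, Nat.reduceDiv, map_add, map_neg, map_zero, LinearMap.map_neg,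
      Module.Basis.coord_apply, repr_mk_neg, repr_mk_monomial, repr_mk_zero, Finsupp.single_apply, Finsupp.coe_add,
      Finsupp.coe_neg, Finsupp.coe_zero, Pi.zero_apply, boxIdx, quo, e_apply_zero, e_apply_one, e_apply_two,
      scMonomial_e_zero_one, scMonomial_e_zero_neg_one, Pi.single_apply, if_true, if_false, neg_zero, neg_neg,
      add_zero, zero_add, neg_add_cancel, add_neg_cancel, Fin.mk.injEq, Fin.ext_iff, Fin.val_zero, Fin.val_one, Fin.val_two]

/-- `piv (w 7) = e_7` (18 coordinate evaluations). [OURS · certificate] -/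
theorem piv_w_7 : piv k (w k 7) = Pi.single 7 1 :=
  ext18 fun p hp => by
    fin_cases hp <;> simp +decide only [piv_apply, pivJ, pivG, Matrix.cons_val, Fin.isValue, w, gen, col,
      Pi.smul_apply, Pi.add_apply, Pi.neg_apply, Pi.sub_apply, smul_eq_mul, kc3DW, Matrix.of_apply, kc3D,
      boxMonomial, box, MulMemClass.mk_mul_mk, monomial_mul, mul_one, one_mul, mul_neg, mul_zero, e_add,
      Nat.reduceAdd, Nat.reduceMul, Nat.reduceMod, Nat.reduceDiv, map_add, map_neg, map_zero, LinearMap.map_neg,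
      Module.Basis.coord_apply, repr_mk_neg, repr_mk_monomial, repr_mk_zero, Finsupp.single_apply, Finsupp.coe_add,
      Finsupp.coe_neg, Finsupp.coe_zero, Pi.zero_apply, boxIdx, quo, e_apply_zero, e_apply_one, e_apply_two,
      scMonomial_e_zero_one, scMonomial_e_zero_neg_one, Pi.single_apply, if_true, if_false, neg_zero, neg_neg,
      add_zero, zero_add, neg_add_cancel, add_neg_cancel, Fin.mk.injEq, Fin.ext_iff, Fin.val_zero, Fin.val_one, Fin.val_two]

/-- `piv (w 8) = e_8` (18 coordinate evaluations). [OURS · certificate] -/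
theorem piv_w_8 : piv k (w k 8) = Pi.single 8 1 :=
  ext18 fun p hp => by
    fin_cases hp <;> simp +decide only [piv_apply, pivJ, pivG, Matrix.cons_val, Fin.isValue, w, gen, col,
      Pi.smul_apply, Pi.add_apply, Pi.neg_apply, Pi.sub_apply, smul_eq_mul, kc3DW, Matrix.of_apply, kc3D,
      boxMonomial, box, MulMemClass.mk_mul_mk, monomial_mul, mul_one, one_mul, mul_neg, mul_zero, e_add,
      Nat.reduceAdd, Nat.reduceMul, Nat.reduceMod, Nat.reduceDiv, map_add, map_neg, map_zero, LinearMap.map_neg,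
      Module.Basis.coord_apply, repr_mk_neg, repr_mk_monomial, repr_mk_zero, Finsupp.single_apply, Finsupp.coe_add,
      Finsupp.coe_neg, Finsupp.coe_zero, Pi.zero_apply, boxIdx, quo, e_apply_zero, e_apply_one, e_apply_two,
      scMonomial_e_zero_one, scMonomial_e_zero_neg_one, Pi.single_apply, if_true, if_false, neg_zero, neg_neg,
      add_zero, zero_add, neg_add_cancel, add_neg_cancel, Fin.mk.injEq, Fin.ext_iff, Fin.val_zero, Fin.val_one, Fin.val_two]

/-- `piv (w 9) = e_9` (18 coordinate evaluations). [OURS · certificate] -/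
theorem piv_w_9 : piv k (w k 9) = Pi.single 9 1 :=
  ext18 fun p hp => by
    fin_cases hp <;> simp +decide only [piv_apply, pivJ, pivG, Matrix.cons_val, Fin.isValue, w, gen, col,
      Pi.smul_apply, Pi.add_apply, Pi.neg_apply, Pi.sub_apply, smul_eq_mul, kc3DW, Matrix.of_apply, kc3D,
      boxMonomial, box, MulMemClass.mk_mul_mk, monomial_mul, mul_one, one_mul, mul_neg, mul_zero, e_add,
      Nat.reduceAdd, Nat.reduceMul, Nat.reduceMod, Nat.reduceDiv, map_add, map_neg, map_zero, LinearMap.map_neg,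
      Module.Basis.coord_apply, repr_mk_neg, repr_mk_monomial, repr_mk_zero, Finsupp.single_apply, Finsupp.coe_add,
      Finsupp.coe_neg, Finsupp.coe_zero, Pi.zero_apply, boxIdx, quo, e_apply_zero, e_apply_one, e_apply_two,
      scMonomial_e_zero_one, scMonomial_e_zero_neg_one, Pi.single_apply, if_true, if_false, neg_zero, neg_neg,
      add_zero, zero_add, neg_add_cancel, add_neg_cancel, Fin.mk.injEq, Fin.ext_iff, Fin.val_zero, Fin.val_one, Fin.val_two]

/-- `piv (w 10) = e_10` (18 coordinate evaluations). [OURS · certificate] -/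
theorem piv_w_10 : piv k (w k 10) = Pi.single 10 1 :=
  ext18 fun p hp => by
    fin_cases hp <;> simp +decide only [piv_apply, pivJ, pivG, Matrix.cons_val, Fin.isValue, w, gen, col,
      Pi.smul_apply, Pi.add_apply, Pi.neg_apply, Pi.sub_apply, smul_eq_mul, kc3DW, Matrix.of_apply, kc3D,
      boxMonomial, box, MulMemClass.mk_mul_mk, monomial_mul, mul_one, one_mul, mul_neg, mul_zero, e_add,
      Nat.reduceAdd, Nat.reduceMul, Nat.reduceMod, Nat.reduceDiv, map_add, map_neg, map_zero, LinearMap.map_neg,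
      Module.Basis.coord_apply, repr_mk_neg, repr_mk_monomial, repr_mk_zero, Finsupp.single_apply, Finsupp.coe_add,
      Finsupp.coe_neg, Finsupp.coe_zero, Pi.zero_apply, boxIdx, quo, e_apply_zero, e_apply_one, e_apply_two,
      scMonomial_e_zero_one, scMonomial_e_zero_neg_one, Pi.single_apply, if_true, if_false, neg_zero, neg_neg,
      add_zero, zero_add, neg_add_cancel, add_neg_cancel, Fin.mk.injEq, Fin.ext_iff, Fin.val_zero, Fin.val_one, Fin.val_two]

/-- `piv (w 11) = e_11` (18 coordinate evaluations). [OURS · certificate] -/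
theorem piv_w_11 : piv k (w k 11) = Pi.single 11 1 :=
  ext18 fun p hp => by
    fin_cases hp <;> simp +decide only [piv_apply, pivJ, pivG, Matrix.cons_val, Fin.isValue, w, gen, col,
      Pi.smul_apply, Pi.add_apply, Pi.neg_apply, Pi.sub_apply, smul_eq_mul, kc3DW, Matrix.of_apply, kc3D,
      boxMonomial, box, MulMemClass.mk_mul_mk, monomial_mul, mul_one, one_mul, mul_neg, mul_zero, e_add,
      Nat.reduceAdd, Nat.reduceMul, Nat.reduceMod, Nat.reduceDiv, map_add, map_neg, map_zero, LinearMap.map_neg,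
      Module.Basis.coord_apply, repr_mk_neg, repr_mk_monomial, repr_mk_zero, Finsupp.single_apply, Finsupp.coe_add,
      Finsupp.coe_neg, Finsupp.coe_zero, Pi.zero_apply, boxIdx, quo, e_apply_zero, e_apply_one, e_apply_two,
      scMonomial_e_zero_one, scMonomial_e_zero_neg_one, Pi.single_apply, if_true, if_false, neg_zero, neg_neg,
      add_zero, zero_add, neg_add_cancel, add_neg_cancel, Fin.mk.injEq, Fin.ext_iff, Fin.val_zero, Fin.val_one, Fin.val_two]

/-- `piv (w 12) = e_12` (18 coordinate evaluations). [OURS · certificate] -/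
theorem piv_w_12 : piv k (w k 12) = Pi.single 12 1 :=
  ext18 fun p hp => by
    fin_cases hp <;> simp +decide only [piv_apply, pivJ, pivG, Matrix.cons_val, Fin.isValue, w, gen, col,
      Pi.smul_apply, Pi.add_apply, Pi.neg_apply, Pi.sub_apply, smul_eq_mul, kc3DW, Matrix.of_apply, kc3D,
      boxMonomial, box, MulMemClass.mk_mul_mk, monomial_mul, mul_one, one_mul, mul_neg, mul_zero, e_add,
      Nat.reduceAdd, Nat.reduceMul, Nat.reduceMod, Nat.reduceDiv, map_add, map_neg, map_zero, LinearMap.map_neg,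
      Module.Basis.coord_apply, repr_mk_neg, repr_mk_monomial, repr_mk_zero, Finsupp.single_apply, Finsupp.coe_add,
      Finsupp.coe_neg, Finsupp.coe_zero, Pi.zero_apply, boxIdx, quo, e_apply_zero, e_apply_one, e_apply_two,
      scMonomial_e_zero_one, scMonomial_e_zero_neg_one, Pi.single_apply, if_true, if_false, neg_zero, neg_neg,
      add_zero, zero_add, neg_add_cancel, add_neg_cancel, Fin.mk.injEq, Fin.ext_iff, Fin.val_zero, Fin.val_one, Fin.val_two]

/-- `piv (w 13) = e_13` (18 coordinate evaluations). [OURS · certificate] -/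
theorem piv_w_13 : piv k (w k 13) = Pi.single 13 1 :=
  ext18 fun p hp => by
    fin_cases hp <;> simp +decide only [piv_apply, pivJ, pivG, Matrix.cons_val, Fin.isValue, w, gen, col,
      Pi.smul_apply, Pi.add_apply, Pi.neg_apply, Pi.sub_apply, smul_eq_mul, kc3DW, Matrix.of_apply, kc3D,
      boxMonomial, box, MulMemClass.mk_mul_mk, monomial_mul, mul_one, one_mul, mul_neg, mul_zero, e_add,
      Nat.reduceAdd, Nat.reduceMul, Nat.reduceMod, Nat.reduceDiv, map_add, map_neg, map_zero, LinearMap.map_neg,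
      Module.Basis.coord_apply, repr_mk_neg, repr_mk_monomial, repr_mk_zero, Finsupp.single_apply, Finsupp.coe_add,
      Finsupp.coe_neg, Finsupp.coe_zero, Pi.zero_apply, boxIdx, quo, e_apply_zero, e_apply_one, e_apply_two,
      scMonomial_e_zero_one, scMonomial_e_zero_neg_one, Pi.single_apply, if_true, if_false, neg_zero, neg_neg,
      add_zero, zero_add, neg_add_cancel, add_neg_cancel, Fin.mk.injEq, Fin.ext_iff, Fin.val_zero, Fin.val_one, Fin.val_two]

/-- `piv (w 14) = e_14` (18 coordinate evaluations). [OURS · certificate] -/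
theorem piv_w_14 : piv k (w k 14) = Pi.single 14 1 :=
  ext18 fun p hp => by
    fin_cases hp <;> simp +decide only [piv_apply, pivJ, pivG, Matrix.cons_val, Fin.isValue, w, gen, col,
      Pi.smul_apply, Pi.add_apply, Pi.neg_apply, Pi.sub_apply, smul_eq_mul, kc3DW, Matrix.of_apply, kc3D,
      boxMonomial, box, MulMemClass.mk_mul_mk, monomial_mul, mul_one, one_mul, mul_neg, mul_zero, e_add,
      Nat.reduceAdd, Nat.reduceMul, Nat.reduceMod, Nat.reduceDiv, map_add, map_neg, map_zero, LinearMap.map_neg,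
      Module.Basis.coord_apply, repr_mk_neg, repr_mk_monomial, repr_mk_zero, Finsupp.single_apply, Finsupp.coe_add,
      Finsupp.coe_neg, Finsupp.coe_zero, Pi.zero_apply, boxIdx, quo, e_apply_zero, e_apply_one, e_apply_two,
      scMonomial_e_zero_one, scMonomial_e_zero_neg_one, Pi.single_apply, if_true, if_false, neg_zero, neg_neg,
      add_zero, zero_add, neg_add_cancel, add_neg_cancel, Fin.mk.injEq, Fin.ext_iff, Fin.val_zero, Fin.val_one, Fin.val_two]

/-- `piv (w 15) = e_15` (18 coordinate evaluations). [OURS · certificate] -/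
theorem piv_w_15 : piv k (w k 15) = Pi.single 15 1 :=
  ext18 fun p hp => by
    fin_cases hp <;> simp +decide only [piv_apply, pivJ, pivG, Matrix.cons_val, Fin.isValue, w, gen, col,
      Pi.smul_apply, Pi.add_apply, Pi.neg_apply, Pi.sub_apply, smul_eq_mul, kc3DW, Matrix.of_apply, kc3D,
      boxMonomial, box, MulMemClass.mk_mul_mk, monomial_mul, mul_one, one_mul, mul_neg, mul_zero, e_add,
      Nat.reduceAdd, Nat.reduceMul, Nat.reduceMod, Nat.reduceDiv, map_add, map_neg, map_zero, LinearMap.map_neg,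
      Module.Basis.coord_apply, repr_mk_neg, repr_mk_monomial, repr_mk_zero, Finsupp.single_apply, Finsupp.coe_add,
      Finsupp.coe_neg, Finsupp.coe_zero, Pi.zero_apply, boxIdx, quo, e_apply_zero, e_apply_one, e_apply_two,
      scMonomial_e_zero_one, scMonomial_e_zero_neg_one, Pi.single_apply, if_true, if_false, neg_zero, neg_neg,
      add_zero, zero_add, neg_add_cancel, add_neg_cancel, Fin.mk.injEq, Fin.ext_iff, Fin.val_zero, Fin.val_one, Fin.val_two]

/-- `piv (w 16) = e_16` (18 coordinate evaluations). [OURS · certificate] -/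
theorem piv_w_16 : piv k (w k 16) = Pi.single 16 1 :=
  ext18 fun p hp => by
    fin_cases hp <;> simp +decide only [piv_apply, pivJ, pivG, Matrix.cons_val, Fin.isValue, w, gen, col,
      Pi.smul_apply, Pi.add_apply, Pi.neg_apply, Pi.sub_apply, smul_eq_mul, kc3DW, Matrix.of_apply, kc3D,
      boxMonomial, box, MulMemClass.mk_mul_mk, monomial_mul, mul_one, one_mul, mul_neg, mul_zero, e_add,
      Nat.reduceAdd, Nat.reduceMul, Nat.reduceMod, Nat.reduceDiv, map_add, map_neg, map_zero, LinearMap.map_neg,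
      Module.Basis.coord_apply, repr_mk_neg, repr_mk_monomial, repr_mk_zero, Finsupp.single_apply, Finsupp.coe_add,
      Finsupp.coe_neg, Finsupp.coe_zero, Pi.zero_apply, boxIdx, quo, e_apply_zero, e_apply_one, e_apply_two,
      scMonomial_e_zero_one, scMonomial_e_zero_neg_one, Pi.single_apply, if_true, if_false, neg_zero, neg_neg,
      add_zero, zero_add, neg_add_cancel, add_neg_cancel, Fin.mk.injEq, Fin.ext_iff, Fin.val_zero, Fin.val_one, Fin.val_two]

/-- `piv (w 17) = e_17` (18 coordinate evaluations). [OURS · certificate] -/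
theorem piv_w_17 : piv k (w k 17) = Pi.single 17 1 :=
  ext18 fun p hp => by
    fin_cases hp <;> simp +decide only [piv_apply, pivJ, pivG, Matrix.cons_val, Fin.isValue, w, gen, col,
      Pi.smul_apply, Pi.add_apply, Pi.neg_apply, Pi.sub_apply, smul_eq_mul, kc3DW, Matrix.of_apply, kc3D,
      boxMonomial, box, MulMemClass.mk_mul_mk, monomial_mul, mul_one, one_mul, mul_neg, mul_zero, e_add,
      Nat.reduceAdd, Nat.reduceMul, Nat.reduceMod, Nat.reduceDiv, map_add, map_neg, map_zero, LinearMap.map_neg,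
      Module.Basis.coord_apply, repr_mk_neg, repr_mk_monomial, repr_mk_zero, Finsupp.single_apply, Finsupp.coe_add,
      Finsupp.coe_neg, Finsupp.coe_zero, Pi.zero_apply, boxIdx, quo, e_apply_zero, e_apply_one, e_apply_two,
      scMonomial_e_zero_one, scMonomial_e_zero_neg_one, Pi.single_apply, if_true, if_false, neg_zero, neg_neg,
      add_zero, zero_add, neg_add_cancel, add_neg_cancel, Fin.mk.injEq, Fin.ext_iff, Fin.val_zero, Fin.val_one, Fin.val_two]

/-- `piv (w q) = e_q` for every pivot vector. [OURS · certificate] -/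
theorem piv_w (q : Fin 18) : piv k (w k q) = Pi.single q 1 := by
  fin_cases q
  exacts [piv_w_0, piv_w_1, piv_w_2, piv_w_3, piv_w_4, piv_w_5, piv_w_6, piv_w_7, piv_w_8, piv_w_9,
    piv_w_10, piv_w_11, piv_w_12, piv_w_13, piv_w_14, piv_w_15, piv_w_16, piv_w_17]

/-! ## K4e -/

/-- `W₀⁸` is a projective `P₀`-module (`W₀` is `P₀`-free on the box basis). [folklore] -/
theorem projective_pi : Module.Projective ↥(kc3P k) (Fin 8 → ↥(kc3W k)) := by
  haveI : Module.Free ↥(kc3P k) ↥(kc3W k) := Module.Free.of_basis (kc3Basis k)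
  infer_instance

/-- **K-C3 K4e: `X_b` is a lattice over the Frobenius order `W₀ ⊇ P₀ = k[a⁶,b³,c²]`** —
`Module.Projective ↥(kc3P k) (kc3Xb k)`.  The relation module `N = ∂ W₀¹²` restricted to `P₀` is spanned by
eighteen vectors with a clean pivot reading (`restrictScalars_range_eq_span`, `piv_w`), so `X_b = W₀⁸ ⧸ N`
is a retract of the `P₀`-free module `W₀⁸` (`projective_quotient_restrictScalars_of_pivots`).  This is the
hypothesis `[Module.Projective ↥(kc3P k) L]`, `L := kc3Xb k`, of res-D-pv-037's K5 socket
`not_mem_cohomologyAnnihilator(OfDegree)_of_kc3Lattice_isLocalization`. [OURS · K-C3-REPRO §2, certificate] -/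
theorem kc3Xb_projective : Module.Projective ↥(kc3P k) (kc3Xb k) := by
  haveI := projective_pi (k := k)
  exact projective_quotient_restrictScalars_of_pivots (P := ↥(kc3P k))
    (LinearMap.range (kc3DW k).mulVecLin) (w k) (piv k) piv_w restrictScalars_range_eq_span

/-- **K4e as an instance**, so that res-D-pv-037's socket and res-L1-w44b-lead-1's `kc3.lean` find
`[Module.Projective ↥(kc3P k) (kc3Xb k)]` by `inferInstance`. [OURS] -/
instance kc3Xb.instProjective : Module.Projective ↥(kc3P k) (kc3Xb k) := kc3Xb_projective

end Summit.ResolutionOfSingularities.ResolutionOfSingularities.Theorems.HomologicalConductor.KC3XbLattice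

end
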